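import Summits.QuantumAdvantage.AdviceFreeQNC0.TensorBlockSplit
import Literature.Computability.MetaComplexity.HypercubeSchwartzZippel
import HarnessLib

/-!
# Cell qa-qnc0 (rung F-Q1, route RingFrame, crux α `RingToElim`): the SYMMETRY AXIS and the
# THREE-CHARGE LAW of planner qa-qnc0-p2's ROUND-7 (asks R7-a)

Planner qa-qnc0-p2 gen 7, `HOME/qa-qnc0-p2/ROUND-7.md` §2 / `line/Sketch7.lean` (statements VERBATIM
below).  Four bankable supports, all PROVED:

* `erhOfRingHard : ERHOfRingHard` — `RingHard 2 → EquivariantRingHard`: a rotation-equivariant ring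
  strategy `z_b(x) = [p(rot_b x) = 1]` is a ring strategy whose `n` polynomials `p ∘ rot_b` have the
  degree of `p` (`comp_mem_lowDeg_of_coord` along the coordinate permutation `rot_b`).
* `leaderElectDegreeLB : LeaderElectDegreeLB` — low-degree LEADER ELECTION needs degree `≈ log₂ n`:
  a nonzero `p` of degree `≤ D` fires on `≥ 2^{n−D}` inputs (Reed–Muller minimum distance, tree
  `Smolensky.two_pow_le_card_support`), rotations are bijections, so
  `n·2^{n−D} ≤ Σ_x fireCount p x ≤ 2ⁿ + n·ε·2ⁿ`, i.e. `2^{−D} ≤ 1/n + ε`.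
* `threeChargeLaw : ThreeChargeLaw` — for EVERY walk strategy and input, the number of charges
  `c' ∈ {c, c+1, c+2}` at which it wins is even: in `𝔽₂`, `Σ_{c'<3} WIN(c+c') = Σ_g y_g·Σ_{c'} [c+c'+e_g ≢ 0] = 0`
  (`BlockSplitting.nz3_triple`).
* `threeChargeSum : ThreeChargeSum` — hence `Σ_{c'<3} #WIN(c+c') ≤ 2·2ⁿ`: no strategy beats `2/3` at all
  three charges simultaneously.

The cell's lemmas (not in print).  WHAT THIS IS NOT: nothing on α's difficulty (the planner labels
these "bankable; none bears on α"); `LowDegLeaderElection` / `SymmetrizationLemma` / `ERHIffRingHard`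
(ask R7-b) are NOT proved here; no separation.
-/

noncomputable section

open scoped Classical

namespace Summit.QuantumAdvantage.AdviceFreeQNC0

open Finset
open Literature.Computability.QuantumComplexity Literature.Computability.QuantumComplexity.RingHLF
open Literature.Computability.MetaComplexity Literature.Computability.MetaComplexity.Smolensky
open BlockSplitting

/-! ### Sketch7 statements (verbatim, planner qa-qnc0-p2) -/

/-- cyclic rotation of a pattern by `k` positions: `(rot k x)_b = x_{b+k}`. (Sketch7, verbatim.) -/
def rot {n : ℕ} (k : ℕ) (x : Fin n → Bool) : Fin n → Bool :=
  fun b => x ⟨(b.val + k) % n, Nat.mod_lt _ b.pos⟩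

/-- the rotation-EQUIVARIANT ring strategy generated by ONE polynomial `p`: `z_b(x) = [p(rot_b x) = 1]`
(so `z(rot_a x) = rot_a (z x)`). (Sketch7, verbatim.) -/
def eqvStrategy {n : ℕ} (p : CubeFn (ZMod 2) n) (x : Fin n → Bool) : Fin n → Bool :=
  fun b => decide (p (rot b.val x) = 1)

/-- equivariant ring hardness at fixed parameters: every equivariant strategy generated by a polynomial of degree
`≤ D` solves `Rel(C_n)` on at most `θ·2ⁿ` patterns. (Sketch7, verbatim.) -/
def EqvRingHardAt (n D : ℕ) (θ : ℝ) : Prop :=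
  ∀ p : CubeFn (ZMod 2) n, p ∈ lowDeg (ZMod 2) n D →
    ((univ.filter fun x : Fin n → Bool => Rel x (eqvStrategy p x)).card : ℝ) ≤ θ * (2 : ℝ) ^ n

/-- **ERH**: equivariant ring hardness at polylog degree with a constant `θ < 1`. (Sketch7, verbatim.) -/
def EquivariantRingHard : Prop :=
  ∃ θ : ℝ, θ < 1 ∧ ∀ c : ℕ, ∃ n₀ : ℕ, ∀ n ≥ n₀, EqvRingHardAt n ((Nat.log 2 n) ^ c) θ

/-- support (PROVABLE NOW): ERH is a special case of the crux conclusion `RingHard 2`. (Sketch7, verbatim.) -/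
def ERHOfRingHard : Prop := RingHard 2 → EquivariantRingHard

/-- firing count of the equivariant map generated by `p`: the number of rotations of `x` at which `p` fires.
(Sketch7, verbatim.) -/
def fireCount {n : ℕ} (p : CubeFn (ZMod 2) n) (x : Fin n → Bool) : ℕ :=
  (univ.filter fun b : Fin n => p (rot b.val x) = 1).card

/-- low-degree LEADER ELECTION at parameters `(n, D, ε)`: some polynomial of degree `≤ D` fires at EXACTLY ONE rotation
on all but `ε·2ⁿ` inputs. (Sketch7, verbatim.) -/
def LeaderElect (n D : ℕ) (ε : ℝ) : Prop :=
  ∃ p : CubeFn (ZMod 2) n, p ∈ lowDeg (ZMod 2) n D ∧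
    ((univ.filter fun x : Fin n → Bool => fireCount p x ≠ 1).card : ℝ) ≤ ε * (2 : ℝ) ^ n

/-- **LE lower bound (DeMillo–Lipton–Schwartz–Zippel counting)**: a nonzero polynomial of degree `≤ D`
fires on `≥ 2^{n−D}` inputs, so `n·2^{−D} ≤ E[fireCount] ≤ 1 + n·ε`; i.e. success `1 − ε` forces `2^{−D} ≤ 1/n + ε`.
(Sketch7, verbatim.) -/
def LeaderElectDegreeLB : Prop :=
  ∀ (n D : ℕ) (ε : ℝ), 0 < n → LeaderElect n D ε → (1 : ℝ) / 2 ^ D ≤ 1 / n + ε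

/-- **THREE-CHARGE LAW**: at every input, a walk strategy wins at an EVEN number (`0` or `2`) of the three charges.
(Sketch7, verbatim.) -/
def ThreeChargeLaw : Prop :=
  ∀ (n c : ℕ) (y : Fin (n + 1) → (Fin n → Bool) → Bool) (u : Fin n → Bool),
    ((range 3).filter fun c' => ringWinU (c + c') y u = true).card % 2 = 0

/-- consequence: `Σ_{c' < 3} #WIN(c + c', y) ≤ 2·2ⁿ` for EVERY strategy — no strategy beats `2/3` at all three charges.
(Sketch7, verbatim.) -/
def ThreeChargeSum : Prop :=
  ∀ (n c : ℕ) (y : Fin (n + 1) → (Fin n → Bool) → Bool),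
    ∑ c' ∈ range 3, (univ.filter fun u : Fin n → Bool => ringWinU (c + c') y u = true).card ≤ 2 * 2 ^ n

namespace RingSymmetry

variable {n : ℕ}

/-! ### Rotations -/

/-- The index shift `b ↦ b + k (mod n)`. -/
def shift (n k : ℕ) (b : Fin n) : Fin n := ⟨(b.val + k) % n, Nat.mod_lt _ b.pos⟩

/-- `rot k x = x ∘ shift k`. -/
theorem rot_eq_comp (k : ℕ) (x : Fin n → Bool) : rot k x = x ∘ shift n k := rfl

/-- The shift is injective (hence a permutation of `Fin n`). -/
theorem shift_injective (k : ℕ) : Function.Injective (shift n k) := by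
  intro a b h
  have h' := congrArg Fin.val h
  simp only [shift] at h'
  apply Fin.ext
  have ha := a.isLt
  have hb := b.isLt
  have := Nat.ModEq.add_right_cancel' k (h' : (a.val + k) % n = (b.val + k) % n)
  have e : a.val % n = b.val % n := this
  rwa [Nat.mod_eq_of_lt ha, Nat.mod_eq_of_lt hb] at e

/-- Rotation of patterns is injective. -/
theorem rot_injective (k : ℕ) : Function.Injective (rot (n := n) k) := by
  intro x y h
  have hs : Function.Surjective (shift n k) := Finite.surjective_of_injective (shift_injective k)
  funext i
  obtain ⟨b, rfl⟩ := hs i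
  have := congrFun h b
  simpa [rot_eq_comp] using this

/-- Rotation of patterns is a bijection, so it preserves the number of inputs where `p` fires. -/
theorem card_fires_rot (p : CubeFn (ZMod 2) n) (k : ℕ) :
    (univ.filter fun x : Fin n → Bool => p (rot k x) = 1).card =
      (univ.filter fun x : Fin n → Bool => p x = 1).card := by
  have hs : Function.Surjective (rot (n := n) k) := Finite.surjective_of_injective (rot_injective k)
  refine card_bij (fun x _ => rot k x) (fun x hx => ?_) (fun x _ y _ h => rot_injective k h)
    (fun y hy => ?_)
  · rw [mem_filter] at hx ⊢; exact ⟨mem_univ _, hx.2⟩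
  · obtain ⟨x, rfl⟩ := hs y
    rw [mem_filter] at hy
    exact ⟨x, mem_filter.2 ⟨mem_univ _, hy.2⟩, rfl⟩

/-- A coordinate of a rotated pattern is a coordinate: degree `≤ 1`. -/
theorem ind_rot_mem (k : ℕ) (j : Fin n) :
    (fun u : Fin n → Bool => if rot k u j = true then (1 : ZMod 2) else 0) ∈ lowDeg (ZMod 2) n 1 := by
  have e : (fun u : Fin n → Bool => if rot k u j = true then (1 : ZMod 2) else 0) =
      mono (ZMod 2) ({shift n k j} : Finset (Fin n)) := by
    funext u
    rw [mono_apply]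
    simp [rot_eq_comp]
  rw [e]
  exact mono_mem_lowDeg (by simp)

/-! ### The win indicator in `𝔽₂` -/

/-- The `𝔽₂`-indicator of a win at charge `ch` is `Σ_g [y_g(u)]·[ch + g + e_g(u) ≢ 0 (3)]`. -/
theorem ind_ringWinU (ch : ℕ) (y : Fin (n + 1) → (Fin n → Bool) → Bool) (u : Fin n → Bool) :
    (if ringWinU ch y u = true then (1 : ZMod 2) else 0) =
      ∑ g : Fin (n + 1), (if y g u = true then (1 : ZMod 2) else 0) *
        nz3 (ch + g.val + walkExp u g.val) := by
  unfold ringWinU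
  have e0 : (if decide (((univ.filter fun g : Fin (n + 1) =>
        y g u = true ∧ (ch + g.val + walkExp u g.val) % 3 ≠ 0).card) % 2 = 1) = true
        then (1 : ZMod 2) else 0) =
      ((((univ.filter fun g : Fin (n + 1) =>
        y g u = true ∧ (ch + g.val + walkExp u g.val) % 3 ≠ 0).card) : ℕ) : ZMod 2) := by
    by_cases h : ((univ.filter fun g : Fin (n + 1) =>
        y g u = true ∧ (ch + g.val + walkExp u g.val) % 3 ≠ 0).card) % 2 = 1
    · rw [if_pos (decide_eq_true h), (mod_two_eq_one_iff _).1 h]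
    · rw [if_neg (by simpa using h)]
      have h0 : ((univ.filter fun g : Fin (n + 1) =>
          y g u = true ∧ (ch + g.val + walkExp u g.val) % 3 ≠ 0).card) % 2 = 0 := by omega
      rw [(ZMod.natCast_eq_zero_iff_even).2 (Nat.even_iff.2 h0)]
  rw [e0, card_filter_mod_two]
  refine sum_congr rfl fun g _ => ?_
  unfold nz3
  by_cases h1 : y g u = true <;> by_cases h2 : (ch + g.val + walkExp u g.val) % 3 = 0 <;> simp [h1, h2]

end RingSymmetry

open RingSymmetry

/-! ### The four supports -/

/-- **`ERHOfRingHard` — PROVED**: `RingHard 2 → EquivariantRingHard`. -/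
theorem erhOfRingHard : ERHOfRingHard := by
  intro h
  obtain ⟨θ, hθ, hc⟩ := h
  refine ⟨θ, hθ, fun c => ?_⟩
  obtain ⟨n₀, hn₀⟩ := hc c
  refine ⟨n₀, fun n hn p hp => ?_⟩
  exact hn₀ n hn (fun i => fun x => p (rot i.val x))
    (fun i => comp_mem_lowDeg_of_coord (rot i.val) (ind_rot_mem i.val) hp)

/-- **`ThreeChargeLaw` — PROVED**: at every input a walk strategy wins at an even number of the three
charges `c, c+1, c+2`. -/
theorem threeChargeLaw : ThreeChargeLaw := by
  intro n c y u
  have hsum : ((((range 3).filter fun c' => ringWinU (c + c') y u = true).card : ℕ) : ZMod 2) = 0 := by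
    rw [card_filter_mod_two]
    simp only [ind_ringWinU]
    rw [sum_comm]
    refine sum_eq_zero fun g _ => ?_
    rw [← mul_sum]
    have e : ∀ c' : ℕ, c + c' + g.val + walkExp u g.val = (c + g.val + walkExp u g.val) + 1 * c' :=
      fun c' => by ring
    simp only [e, sum_range_succ, sum_range_zero, zero_add]
    rw [nz3_triple _ 1 (Or.inl rfl), mul_zero]
  have := (ZMod.natCast_eq_zero_iff_even).1 hsum
  exact Nat.even_iff.1 this

/-- **`ThreeChargeSum` — PROVED**: `Σ_{c'<3} #WIN(c + c') ≤ 2·2ⁿ` for every strategy. -/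
theorem threeChargeSum : ThreeChargeSum := by
  intro n c y
  have e : ∑ c' ∈ range 3, (univ.filter fun u : Fin n → Bool => ringWinU (c + c') y u = true).card =
      ∑ u : Fin n → Bool, ((range 3).filter fun c' => ringWinU (c + c') y u = true).card := by
    simp only [card_filter]
    exact sum_comm
  rw [e]
  have hle : ∀ u : Fin n → Bool, ((range 3).filter fun c' => ringWinU (c + c') y u = true).card ≤ 2 := by
    intro u
    have h3 : ((range 3).filter fun c' => ringWinU (c + c') y u = true).card ≤ 3 :=
      (card_filter_le _ _).trans (by simp)
    have hev := threeChargeLaw n c y u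
    omega
  calc ∑ u : Fin n → Bool, ((range 3).filter fun c' => ringWinU (c + c') y u = true).card
      ≤ ∑ _u : Fin n → Bool, 2 := sum_le_sum fun u _ => hle u
    _ = 2 * 2 ^ n := by
        rw [sum_const, card_univ, Fintype.card_fun, Fintype.card_bool, Fintype.card_fin, smul_eq_mul,
          mul_comm]

/-- **`LeaderElectDegreeLB` — PROVED**: leader election with failure `≤ ε` at degree `D` forces
`2^{−D} ≤ 1/n + ε` (Reed–Muller minimum distance + rotation invariance of the count). -/
theorem leaderElectDegreeLB : LeaderElectDegreeLB := by
  intro n D ε hn hLE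
  obtain ⟨p, hp, hbad⟩ := hLE
  have hnR : (0 : ℝ) < n := by exact_mod_cast hn
  have h2n : (0 : ℝ) < (2 : ℝ) ^ n := by positivity
  have h2D : (0 : ℝ) < (2 : ℝ) ^ D := by positivity
  -- `fireCount ≤ n` and the bad set
  set Bad := univ.filter fun x : Fin n → Bool => fireCount p x ≠ 1 with hBad
  have hfc_le : ∀ x, fireCount p x ≤ n := fun x =>
    (card_filter_le _ _).trans (by rw [card_univ, Fintype.card_fin])
  -- `Σ_x fireCount p x ≤ 2^n + n·#Bad`
  have hupper : ∑ x : Fin n → Bool, fireCount p x ≤ 2 ^ n + n * Bad.card := by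
    have h1 : ∀ x : Fin n → Bool, fireCount p x ≤ 1 + (if fireCount p x ≠ 1 then n else 0) := by
      intro x
      by_cases h : fireCount p x ≠ 1
      · rw [if_pos h]; have := hfc_le x; omega
      · rw [if_neg h]; have h' := not_ne_iff.1 h; omega
    calc ∑ x : Fin n → Bool, fireCount p x
        ≤ ∑ x : Fin n → Bool, (1 + (if fireCount p x ≠ 1 then n else 0)) := sum_le_sum fun x _ => h1 x
      _ = 2 ^ n + n * Bad.card := by
          rw [sum_add_distrib, sum_const, card_univ, Fintype.card_fun, Fintype.card_bool,
            Fintype.card_fin, smul_eq_mul, mul_one, ← sum_filter, sum_const, smul_eq_mul, mul_comm]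
  -- `Σ_x fireCount p x = n · #{x : p x = 1}`
  have hlower : ∑ x : Fin n → Bool, fireCount p x = n * (univ.filter fun x : Fin n → Bool => p x = 1).card := by
    unfold fireCount
    simp only [card_filter]
    rw [sum_comm]
    simp only [← card_filter, card_fires_rot]
    rw [sum_const, card_univ, Fintype.card_fin, smul_eq_mul]
  -- Reed–Muller: a nonzero `p` fires on `≥ 2^{n-D}` inputs
  by_cases hp0 : p = 0
  · -- `p = 0`: nobody ever fires, so every input is bad: `2^n ≤ ε·2^n`
    have hall : Bad.card = 2 ^ n := by
      rw [hBad, filter_true_of_mem, card_univ, Fintype.card_fun, Fintype.card_bool, Fintype.card_fin]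
      intro x _
      unfold fireCount
      rw [hp0]
      simp
    have hε : 1 ≤ ε := by
      have : ((2 ^ n : ℕ) : ℝ) ≤ ε * (2 : ℝ) ^ n := by rw [← hall]; exact hbad
      push_cast at this
      nlinarith
    have h1 : (1 : ℝ) / 2 ^ D ≤ 1 := by
      rw [div_le_one h2D]; exact one_le_pow₀ (by norm_num)
    have h2 : (0 : ℝ) < 1 / n := by positivity
    linarith
  · have hfires : 2 ^ (n - D) ≤ (univ.filter fun x : Fin n → Bool => p x = 1).card := by
      have h := two_pow_le_card_support hp hp0
      have e : (univ.filter fun x : Fin n → Bool => p x ≠ 0) =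
          univ.filter fun x : Fin n → Bool => p x = 1 := by
        refine filter_congr fun x _ => ?_
        constructor
        · intro h1
          have : ∀ a : ZMod 2, a ≠ 0 → a = 1 := by decide
          exact this _ h1
        · intro h1; rw [h1]; exact one_ne_zero
      rwa [e] at h
    -- combine: `n · 2^{n-D} ≤ 2^n + n·ε·2^n`
    have hchain : n * 2 ^ (n - D) ≤ 2 ^ n + n * Bad.card :=
      (Nat.mul_le_mul_left n hfires).trans (hlower ▸ hupper)
    have hchainR : (n : ℝ) * (2 : ℝ) ^ (n - D) ≤ (2 : ℝ) ^ n + n * (Bad.card : ℝ) := by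
      exact_mod_cast hchain
    -- `2^{n-D} ≥ 2^n / 2^D` (also when `D > n`)
    have hpow : (2 : ℝ) ^ n / (2 : ℝ) ^ D ≤ (2 : ℝ) ^ (n - D) := by
      rcases Nat.lt_or_ge n D with hDn | hDn
      · rw [Nat.sub_eq_zero_of_le hDn.le, pow_zero, div_le_one h2D]
        exact pow_le_pow_right₀ (by norm_num) hDn.le
      · rw [div_le_iff₀ h2D, ← pow_add, Nat.sub_add_cancel hDn]
    have hB : (Bad.card : ℝ) ≤ ε * (2 : ℝ) ^ n := hbad
    -- divide by `n · 2^n`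
    have key : (n : ℝ) * ((2 : ℝ) ^ n / (2 : ℝ) ^ D) ≤ (2 : ℝ) ^ n + n * (ε * (2 : ℝ) ^ n) := by
      have := mul_le_mul_of_nonneg_left hpow hnR.le
      nlinarith [mul_le_mul_of_nonneg_left hB hnR.le]
    have key' : (n : ℝ) * (2 : ℝ) ^ n * (1 / (2 : ℝ) ^ D) ≤ (n : ℝ) * (2 : ℝ) ^ n * (1 / n + ε) := by
      have e1 : (n : ℝ) * (2 : ℝ) ^ n * (1 / (2 : ℝ) ^ D) = (n : ℝ) * ((2 : ℝ) ^ n / (2 : ℝ) ^ D) := by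
        ring
      have e2 : (n : ℝ) * (2 : ℝ) ^ n * (1 / n + ε) = (2 : ℝ) ^ n + n * (ε * (2 : ℝ) ^ n) := by
        field_simp
      rw [e1, e2]; exact key
    exact le_of_mul_le_mul_left key' (mul_pos hnR h2n)

end Summit.QuantumAdvantage.AdviceFreeQNC0
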